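import Summits.ResolutionOfSingularities.ResolutionOfSingularities.Theorems.ConeCutWalks
import HarnessLib

/-!
# ConeCutLawB — tree file 5/11: §C LAW B — free high plateaux are rigid high floors (boundary ledger only): kept-exponent
monotonicity under newest-free moves, eventual constancy, `IsRigidHighFloorFrom`.  PROVED.  (Letters
`LeavesNewest`/`StaysOnNewest` =
the tree's `ProximityCut` ones.)

Content VERBATIM from the decomp-res lens-3 g15 file `HOME/decomp-res-lens-3/g15/parts/ConeCut-rev5-f76e5309.lean`
(sha256 f76e53096babc227…; CRITIC-LEDGER
rows 102/105/110/123 CLEARED, landing orders 15:53:15Z / 17:40:15Z).  HOME = run/shared/lean/pub/decomp-res.  Host: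
route `MaxContactCut`, aside
31770 `DefectWalksDeep` (and 31870) through the tree's lens-3 g14 `Theorems/FloorCut{Classes,Floor}` + `MaxContactCutFloorCut`.

[WRITER NOTE (decomp-res writer g6): per the lens's own landing instruction its §0 (l.130–876 = g14 `FloorCut`
VERBATIM) is DELETED and the
tree's `…Theorems.FloorCut` opened instead; §C⁵ `section AxisLaw` (l.2949–3086) is the tree's
`Theorems/ConeCutAxisLaw` (landed earlier,
opened here); the restated ProximityCut letters `LeavesNewest` / `StaysOnNewest` / `leavesNewest_iff_not_stays` /
`NoFreePointTailsDeep`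
(byte-identical to `Theorems/ProximityCutClasses`) are deleted and opened from the tree; the three class definitions
`IsTameFrom`,
`NoMixedTailsDeep`, `NoTameMixedTailsDeep` live in the cone-free `Theorems/ConeCutClasses` (so the route can import
the co-owned MIXED
aside).  Split: ConeCutClasses · ConeCutLayers / ConeCutLayersPoint (§A state level) · ConeCutWalks (§B) ·
ConeCutLawB (§C) · ConeCutRepeats
(§B⁺, §B⁺⁺⁺ part 1) · ConeCutLawE (§B⁺⁺⁺ part 2, LAW E) · ConeCutZigzag (§B⁺⁺
Fibonacci/zigzag, LAW C) · ConeCutLaws (all-repeat rigidity,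
LAW I, §D booking) · MaxContactCutConeCut / MaxContactCutConeCutCells (§D wiring to 31770/31870 BY NAME, Theses
cone).  ONE namespace
`…Theorems.ConeCut` as in the lens; global `set_option` lines dropped; nothing else changed.]
(Sources: Hauser2010 §§D,F,G; HauserPerlega2019; Moh1987; CossartPiltant2019; CossartJannsenSaito2020 Thm. 2.14,
§§5,9; BenitoVillamayor2013 §7; CasasAlvero2000 Ch. 3; BierstoneGrigorievMilmanWlodarczyk2011 Def. 3.1.3.)
-/

noncomputable section

open MvPolynomial Finset
open Literature.AlgebraicGeometry.Resolution
open Literature.AlgebraicGeometry.Resolution.Hauser2010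
open Literature.AlgebraicGeometry.Resolution.PointBlowup
open Summit.ResolutionOfSingularities.ResolutionOfSingularities.Theorems.TightDefectClasses
open Summit.ResolutionOfSingularities.ResolutionOfSingularities.Theorems.TightDefectStrongWalks
open Summit.ResolutionOfSingularities.ResolutionOfSingularities.Theorems.ItineraryCutClasses
open Summit.ResolutionOfSingularities.ResolutionOfSingularities.Theorems.BoundaryLedger
open Literature.AlgebraicGeometry.Resolution.WeightedBlowup
open Literature.Barriers.ResolutionOfSingularities
open Summit.ResolutionOfSingularities.ResolutionOfSingularities.Theorems.FloorCut
open Summit.ResolutionOfSingularities.ResolutionOfSingularities.Theorems.ConeCutAxisLaw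
open Summit.ResolutionOfSingularities.ResolutionOfSingularities.Theorems.ProximityCut (NoOriginTails LeavesNewest StaysOnNewest)
open Summit.ResolutionOfSingularities.ResolutionOfSingularities.Theorems.ProximityCut (leavesNewest_iff_not_stays NoFreePointTailsDeep)
open Summit.ResolutionOfSingularities.ResolutionOfSingularities.Theorems.ExitLaw (fin3_cases)

namespace Summit.ResolutionOfSingularities.ResolutionOfSingularities.Theorems.ConeCut

section Walks

variable {K : Type} [Field K] [DecidableEq K] {q : ℕ} {s₀ : State (Fin 3) K}

/-- **(B1) A newest-free move keeps at most what was kept before (PROVED)**: `kept_{t+1} ≤ kept_t` pointwise — the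
component created by move `t` is not kept by move `t+1`, and nothing else is new. [new] [folklore] -/
theorem kept_succ_le_of_leavesNewest (W : ForcedWalk q s₀) (t : ℕ) {o : ℕ} (ho : ordZero (W.st t).F = o)
    (hL : LeavesNewest W t) : kept W (t + 1) ≤ kept W t := by
  classical
  refine Finsupp.le_def.mpr fun l => ?_
  rw [kept_apply W (t + 1) l, r_succ_eq W t ho, Finsupp.add_apply, Finsupp.single_apply]
  by_cases hl : l = W.j t
  · -- the newest component is not kept
    rw [if_neg, kept_apply, if_neg (fun h => h.1 hl)]
    rintro ⟨h1, h2⟩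
    rcases hL with h | h
    · exact h1 (hl.trans h.symm)
    · exact h (hl ▸ h2)
  · rw [if_neg (show ¬ (W.j t = l) from fun h => hl h.symm), add_zero]
    split_ifs
    · exact le_rfl
    · exact Nat.zero_le _

/-- … iterated: on a newest-free stretch the kept vectors form a pointwise non-increasing chain. [new] [folklore] -/
theorem kept_le_of_free_stretch (hroot : IsRoot q s₀) (W : ForcedWalk q s₀) {N : ℕ}
    (hfree : ∀ t, N ≤ t → LeavesNewest W t) {t₀ t : ℕ} (h₀ : N ≤ t₀) (ht : t₀ ≤ t) : kept W t ≤ kept W t₀ := by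
  induction t, ht using Nat.le_induction with
  | base => exact le_rfl
  | succ t ht ih =>
    obtain ⟨o, ho, -⟩ := walk_nat hroot W t
    exact (kept_succ_le_of_leavesNewest W t ho (hfree t (by omega))).trans ih

omit [DecidableEq K] in
/-- `a ≤ b` with `|b| ≤ |a|` forces `a = b`. [folklore] -/
theorem finsupp_eq_of_le_of_degree_le {a b : Fin 3 →₀ ℕ} (h : a ≤ b) (hd : b.degree ≤ a.degree) : a = b := by
  obtain ⟨c, rfl⟩ := exists_add_of_le h
  rw [map_add] at hd
  have hc : c = 0 := (Finsupp.degree_eq_zero_iff c).mp (by omega)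
  rw [hc, add_zero]

/-- **(B2) On a newest-free stretch the kept vector is eventually CONSTANT (PROVED).** [new] [folklore] -/
theorem kept_eventually_const (hroot : IsRoot q s₀) (W : ForcedWalk q s₀) {N : ℕ}
    (hfree : ∀ t, N ≤ t → LeavesNewest W t) :
    ∃ M, N ≤ M ∧ ∀ t, M ≤ t → kept W t = kept W M := by
  classical
  have hex : ∃ m, ∃ t, N ≤ t ∧ (kept W t).degree = m := ⟨_, N, le_rfl, rfl⟩
  obtain ⟨t₀, ht₀, hdeg⟩ := Nat.find_spec hex
  have hmin : ∀ t, N ≤ t → (kept W t₀).degree ≤ (kept W t).degree := by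
    intro t ht
    rw [hdeg]
    exact Nat.find_min' hex ⟨t, ht, rfl⟩
  refine ⟨t₀, ht₀, fun t ht => ?_⟩
  exact finsupp_eq_of_le_of_degree_le (kept_le_of_free_stretch hroot W hfree ht₀ ht) (hmin t (by omega))

/-- **(B3) The plateau ledger with constant kept mass (PROVED)**: `o_{t+1} + q = o_t + s + |kept_t|`. [new] [folklore] -/
theorem order_succ_of_plateau (hroot : IsRoot q s₀) (W : ForcedWalk q s₀) (t : ℕ) {o o' s : ℕ}
    (ho : ordZero (W.st t).F = o) (ho' : ordZero (W.st (t + 1)).F = o') (hs : (W.st t).shade = (s : ℕ∞))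
    (hplat : (W.st (t + 1)).shade = (W.st t).shade) : o' + q = o + s + (kept W t).degree := by
  have hled := plateau_ledger hroot W t ho ho' hplat
  obtain ⟨n, hn, hon⟩ := order_eq_shade_add_degree hroot W t ho
  have hns : n = s := by have h := hn.symm.trans hs; exact_mod_cast h
  obtain ⟨o₁, ho₁, hq₁⟩ := walk_nat hroot W t
  have hoo : o₁ = o := by have h := ho₁.symm.trans ho; exact_mod_cast h
  omega

/-- **(B4) NO DRIFT (PROVED)**: on a plateau stretch with constant kept mass `κ`, `s + κ = q` — otherwise the order
would leave the window `q ≤ o < 2q` within `2q` moves. [new] [folklore] -/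
theorem kept_mass_eq (hroot : IsRoot q s₀) (W : ForcedWalk q s₀) {M s κ : ℕ}
    (hplat : ∀ t, M ≤ t → (W.st t).shade = (s : ℕ∞))
    (hk : ∀ t, M ≤ t → (kept W t).degree = κ) : s + κ = q := by
  -- the linear ledger `o_{M+m} + m q = o_M + m (s + κ)`
  obtain ⟨oM, hoM, hqM, hM2⟩ := NoJump.order_lt_two_mul hroot W M
  have hlin : ∀ m : ℕ, ∃ o : ℕ, ordZero (W.st (M + m)).F = o ∧ o + m * q = oM + m * (s + κ) := by
    intro m
    induction m with
    | zero => exact ⟨oM, by rw [Nat.add_zero]; exact hoM, by ring⟩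
    | succ m ih =>
      obtain ⟨o, ho, hlo⟩ := ih
      obtain ⟨o', ho', -⟩ := walk_nat hroot W (M + m + 1)
      have hstep := order_succ_of_plateau hroot W (M + m) ho ho' (hplat _ (by omega))
        (by rw [hplat _ (by omega), hplat _ (by omega)])
      rw [hk _ (by omega)] at hstep
      refine ⟨o', by rw [show M + (m + 1) = M + m + 1 by ring]; exact ho', ?_⟩
      rw [Nat.succ_mul, Nat.succ_mul]
      omega
  by_contra hne
  rcases lt_or_gt_of_ne hne with hlt | hgt
  · -- drift down: the order would become negative
    obtain ⟨o, ho, hlo⟩ := hlin (oM + 1)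
    have h1 : (oM + 1) * (s + κ) + (oM + 1) ≤ (oM + 1) * q := by nlinarith
    omega
  · -- drift up: the order would reach `2q`
    obtain ⟨o, ho, hlo⟩ := hlin q
    obtain ⟨o₁, ho₁, -, h2⟩ := NoJump.order_lt_two_mul hroot W (M + q)
    have hoo : o₁ = o := by have h := ho₁.symm.trans ho; exact_mod_cast h
    have h1 : q * q + q ≤ q * (s + κ) := by nlinarith
    omega

/-- **LAW B — FREE HIGH PLATEAUX ARE RIGID HIGH FLOORS (PROVED, boundary ledger + isolation only).**  On a plateau of
shade `s < q` from states of order `> q` on which every move is eventually NEWEST-FREE and translations recur,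
eventually: the kept vector is the constant `(q − s)·e_i` on ONE label `i`, never the chart and never translated
(`j_t ≠ i`, `b_t(i) = 0`), and the order is the constant `q + a` with `1 ≤ a ≤ s − 1` (so `s ≥ 2`): the boundary
is `r_t = (q−s) e_i + a e_{j_{t−1}}` — the floor cell's shape one storey up. [new] [folklore] -/
theorem free_high_rigid (hroot : IsRoot q s₀) (W : ForcedWalk q s₀) {N s : ℕ} (hsq : s < q)
    (hplat : ∀ t, N ≤ t → (W.st t).shade = (s : ℕ∞) ∧ ((q : ℕ) : ℕ∞) < ordZero (W.st t).F)
    (hfree : ∀ t, N ≤ t → LeavesNewest W t) (hrec : ∀ M : ℕ, ∃ t, M ≤ t ∧ W.b t ≠ 0) :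
    ∃ M : ℕ, ∃ i : Fin 3, ∃ a : ℕ, N ≤ M ∧ 1 ≤ a ∧ a + 1 ≤ s ∧
      ∀ t, M ≤ t → kept W t = Finsupp.single i (q - s) ∧ ordZero (W.st t).F = ((q + a : ℕ) : ℕ∞) ∧
        W.j t ≠ i ∧ W.b t i = 0 := by
  classical
  obtain ⟨M, hNM, hconst⟩ := kept_eventually_const hroot W hfree
  set κv := kept W M with hκv
  have hmass : s + κv.degree = q :=
    kept_mass_eq hroot W (M := M) (fun t ht => (hplat t (by omega)).1) (fun t ht => by rw [hconst t ht])
  -- labels carrying kept mass are never the chart and never translated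
  have hlab : ∀ l, κv l ≠ 0 → ∀ t, M ≤ t → W.j t ≠ l ∧ W.b t l = 0 := by
    intro l hl t ht
    have h := hconst t ht
    have hk : kept W t l ≠ 0 := by rw [h]; exact hl
    rw [kept_apply] at hk
    by_cases hc : l ≠ W.j t ∧ W.b t l = 0
    · exact ⟨Ne.symm hc.1, hc.2⟩
    · rw [if_neg hc] at hk
      exact absurd rfl hk
  -- exactly one label
  have hκ0 : κv ≠ 0 := by
    intro h0
    rw [h0, map_zero] at hmass
    omega
  obtain ⟨i, hi⟩ : ∃ i, κv i ≠ 0 := by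
    by_contra h
    push Not at h
    exact hκ0 (Finsupp.ext h)
  have hone : ∀ l, l ≠ i → κv l = 0 := by
    intro l hli
    by_contra hl
    -- two loaded labels `i ≠ l`: the chart is the third one and the centre is the origin for all `t ≥ M`
    obtain ⟨t, hMt, hbt⟩ := hrec M
    apply hbt
    funext x
    obtain ⟨hji, hbi⟩ := hlab i hi t hMt
    obtain ⟨hjl, hbl⟩ := hlab l hl t hMt
    rcases fin3_cases (Ne.symm hli) hji hjl x with h | h | h
    · rw [h, hbi]; rfl
    · rw [h, hbl]; rfl
    · rw [h]; exact W.onExc t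
  have hκi : κv = Finsupp.single i (q - s) := by
    have hdeg := degree_eq_add_sum_erase i κv
    have h0 : ∑ l ∈ univ.erase i, κv l = 0 :=
      Finset.sum_eq_zero fun l hl => hone l (Finset.ne_of_mem_erase hl)
    ext l
    by_cases hl : l = i
    · rw [hl, Finsupp.single_eq_same]; omega
    · rw [hone l hl, Finsupp.single_eq_of_ne hl]
  -- the order: constant `q + a`
  obtain ⟨oM, hoM, hqM, hM2⟩ := NoJump.order_lt_two_mul hroot W M
  have hord : ∀ t, M ≤ t → ordZero (W.st t).F = (oM : ℕ∞) := by
    intro t ht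
    induction t, ht using Nat.le_induction with
    | base => exact hoM
    | succ t ht ih =>
      obtain ⟨o', ho', -⟩ := walk_nat hroot W (t + 1)
      have hstep := order_succ_of_plateau hroot W t ih ho' (hplat t (by omega)).1
        (by rw [(hplat (t + 1) (by omega)).1, (hplat t (by omega)).1])
      rw [hconst t ht] at hstep
      rw [ho']
      congr 1
      exact_mod_cast (by omega : o' = oM)
  have hqo : q < oM := by
    have h := (hplat M hNM).2
    rw [hoM] at h
    exact_mod_cast h
  -- isolation at `M + 1`: `(q − s) + a < q`
  have hiso : oM - q + 1 ≤ s := by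
    obtain ⟨hjM, -⟩ := hlab i hi M le_rfl
    have hr := r_succ_eq W M hoM
    have hri : (W.st (M + 1)).r i = q - s := by
      rw [hr, Finsupp.add_apply, ← hκv, hκi, Finsupp.single_eq_same, Finsupp.single_eq_of_ne (Ne.symm hjM), add_zero]
    have hrj : (W.st (M + 1)).r (W.j M) = oM - q := by
      rw [hr, Finsupp.add_apply, ← hκv, hκi, Finsupp.single_eq_of_ne hjM, Finsupp.single_eq_same, zero_add]
    have hdvd := X_pow_mul_X_pow_dvd_of_forall_le (walk_r hroot W (M + 1)) (Ne.symm hjM)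
    rw [hri, hrj] at hdvd
    have := pair_lt_of_isolatedTop (W.isolated (M + 1)) i (W.j M) (Ne.symm hjM) hdvd
    omega
  refine ⟨M, i, oM - q, hNM, by omega, by omega, fun t ht => ⟨?_, ?_, (hlab i hi t ht).1, (hlab i hi t ht).2⟩⟩
  · rw [hconst t ht, hκi]
  · rw [hord t ht]
    congr 1
    exact_mod_cast (by omega : oM = q + (oM - q))

/-! ### Two corollaries of the cone law -/

/-- **THE ORIGIN-STEP EXPONENT LAW (PROVED).**  At a plateau step from order `o_t > q` whose centre is the ORIGIN of
the chart (`b_t = 0`), every monomial of the initial form of `F_t` has `u_{j_t}`-exponent EXACTLY `r_t(j_t)`: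
`in_{o_t}(F_t) = u_j^{r_j} · G(u_{≠ j})` — the residual cone does not involve the chart variable at all. [new]
[folklore] -/
theorem apply_eq_of_origin_plateau (hroot : IsRoot q s₀) (W : ForcedWalk q s₀) (t : ℕ) {o : ℕ}
    (ho : ordZero (W.st t).F = o) (hqo : q < o) (hplat : (W.st (t + 1)).shade = (W.st t).shade)
    (hb : W.b t = 0) {d : Fin 3 →₀ ℕ} (hd : d ∈ (W.st t).F.support) (hdo : d.degree = o) :
    d (W.j t) = (W.st t).r (W.j t) := by
  classical
  obtain ⟨n, hn, hon⟩ := order_eq_shade_add_degree hroot W t ho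
  have hcone := (cone_of_plateau hroot W t ho hqo hplat hn).1
  have hres : resForm W t o = resLayer (W.j t) (W.st t) o := by
    unfold resForm
    exact translate_eq_self (W.b t) (fun i => by rw [hb]; rfl) _
  rw [hres] at hcone
  have hrd : (W.st t).r ≤ d := walk_r hroot W t d hd
  have h1 : (d - (W.st t).r).degree + (W.st t).r.degree = d.degree := by
    rw [← map_add, tsub_add_cancel_of_le hrd]
  have hc : coeff ((d - (W.st t).r).update (W.j t) 0) (resLayer (W.j t) (W.st t) o) ≠ 0 := by
    rw [coeff_resLayer (W.j t) (W.st t) (walk_r hroot W t) o (d - (W.st t).r) (by omega), add_tsub_cancel_of_le hrd]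
    exact MvPolynomial.mem_support_iff.mp hd
  have hdeg : ((d - (W.st t).r).update (W.j t) 0).degree = n := by
    by_contra h
    exact hc (hcone.coeff_eq_zero h)
  have h2 := degree_update_add (d - (W.st t).r) (W.j t) 0
  rw [hdeg, Finsupp.tsub_apply] at h2
  have h3 := Finsupp.le_def.mp hrd (W.j t)
  omega

/-- **BINARY ⇒ FREE (PROVED)**: on two consecutive high plateau steps, if the residual form of move `t` is NOT an
`s`-fold line through the next centre, then move `t+1` leaves the newest component. [new] [folklore] -/
theorem leavesNewest_of_not_pow (hroot : IsRoot q s₀) (W : ForcedWalk q s₀) (t : ℕ) {o o' : ℕ}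
    (ho : ordZero (W.st t).F = o) (ho' : ordZero (W.st (t + 1)).F = o') (hqo : q < o) (hqo' : q < o')
    (hplat : (W.st (t + 1)).shade = (W.st t).shade) (hplat' : (W.st (t + 2)).shade = (W.st (t + 1)).shade)
    {n : ℕ} (hn : (W.st t).shade = (n : ℕ∞)) {k : Fin 3} (hki : k ≠ W.j (t + 1)) (hkj : k ≠ W.j t)
    (hbin : ∀ c : K, resForm W t o ≠ C c * (X k - C (W.b (t + 1) k) * X (W.j (t + 1))) ^ n) :
    LeavesNewest W t := by
  rw [leavesNewest_iff_not_stays]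
  intro hS
  obtain ⟨c, -, hc⟩ := resForm_eq_pow_of_repeat hroot W t ho ho' hqo hqo' hplat hplat' hn hS hki hkj
  exact hbin c hc

end Walks

end Summit.ResolutionOfSingularities.ResolutionOfSingularities.Theorems.ConeCut
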